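import Literature.MathematicalPhysics.QuantumLattice.GrassmannKernels
import HarnessLib

/-!
# Relabelling the generators of a finite Grassmann algebra along a bijection

Topic `MathematicalPhysics/QuantumLattice`; companion of `GrassmannLaplacian.lean`,
`GrassmannEffectiveAction.lean` and `GrassmannKernels.lean` (Salmhofer's operator calculus
`Δ_C`, `μ_C ⋆ = e^{Δ_C}`, the Wilsonian effective action `effAction R C V` and the plain-sum kernels
`kernel R F m`).  A bijection `e : Γ ≃ Γ'` of the label sets relabels the generators,
`ψ(X) ↦ ψ(e X)`; as an algebra homomorphism this is Mathlib's
`ExteriorAlgebra.map (LinearMap.funLeft R R e.symm)` (the linear map `v ↦ v ∘ e⁻¹` of the generator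
spaces sends the basis vector of `X` to that of `e X`, `map_funLeft_gen`).  This file proves that
every construction of the three files above is EQUIVARIANT under relabelling:

* `grassmannDeriv_map_funLeft` — `∂_{Y} (F ∘ e⁻¹) = (∂_{e⁻¹ Y} F) ∘ e⁻¹`;
* `grassmannLaplacian_map_funLeft`, `gaussConv_map_funLeft` — `Δ_C (F ∘ e⁻¹) = (Δ_{C ∘ (e × e)} F) ∘ e⁻¹`
  (`C.submatrix e e`), and the same for `μ_C ⋆ = e^{Δ_C}`;
* `constPart_map` (any linear substitution fixes the constant part), `map_funLeft_grassmannExp`,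
  `map_funLeft_grassmannLog1p` (unconditionally: relabelling is injective, so nilpotency classes agree);
* `effBoltzmann_map_funLeft`, `effPartitionFn_map_funLeft`, **`effAction_map_funLeft`** —
  `effAction C (V ∘ e⁻¹) = (effAction (C ∘ (e × e)) V) ∘ e⁻¹`;
* `iterDeriv_map_funLeft`, **`kernel_map_funLeft`** — `kernel (F ∘ e⁻¹) m X = kernel F m (e⁻¹ ∘ X)`
  (no reordering signs: the kernels are iterated derivatives);
* the symmetry corollaries for a permutation `σ` of ONE label set: if `C (σ X) (σ Y) = C X Y` and
  `V ∘ σ⁻¹ = V` then `effAction C V ∘ σ⁻¹ = effAction C V` (`map_funLeft_effAction_of_invariant`),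
  `effPartitionFn` is unchanged, and the kernels of any invariant `F` satisfy
  `kernel F m (σ ∘ X) = kernel F m X` (`kernel_comp_perm_of_invariant`).

This is the form in which the lattice symmetries of a Gaussian Grassmann integration and of the
interaction (Benfatto–Giuliani–Mastropietro 2006, §2.1, symmetries (1) spin exchange and (4) parity;
likewise the point group of the lattice) pass to the effective action and to its kernels in
Salmhofer's `Δ_C` formulation (`GrassmannGaussianSymmetry.lean` treats the Berezin-integral form).

## Sources

G. Benfatto, A. Giuliani, V. Mastropietro, Ann. Henri Poincaré 7 (2006) 809, §2.1 (symmetries of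
`P(dψ)` and `V`; arXiv p. 6 of the held copy) [`BenfattoGiulianiMastropietro2006`]; M. Salmhofer,
*Renormalization* (1999), §4.3 (4.86)–(4.88) [`Salmhofer1999`]; F. A. Berezin, *The Method of Second
Quantization* (1966), Ch. I §3 (automorphisms of the Grassmann algebra induced by linear maps of the
generators) [`Berezin1966`].  All statements here are routine consequences ("folklore").

## Design

No new definitions: the relabelling is written out as `ExteriorAlgebra.map (LinearMap.funLeft R R ⇑e.symm)`
in every statement.  `R` is any commutative ring (`[Algebra ℚ R]` where `exp`, `log`, `Δ_C` or kernels
occur); `Γ, Γ'` are arbitrary (finite where sums over labels occur); no linear order is used.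
-/

noncomputable section

namespace Literature.MathematicalPhysics.QuantumLattice

open GrassmannAlgebra

section Relabel

variable (R : Type*) [CommRing R] {Γ Γ' : Type*}

/-- The substitution `v ↦ v ∘ e⁻¹` of the generator space maps the basis vector of `X` to the basis
vector of `e X`. [folklore] -/
theorem funLeft_symm_single [DecidableEq Γ] [DecidableEq Γ'] (e : Γ ≃ Γ') (X : Γ) (r : R) :
    LinearMap.funLeft R R e.symm (Pi.single X r) = Pi.single (e X) r := by
  change Pi.single X r ∘ e.symm = _
  rw [Pi.single_comp_equiv, Equiv.symm_symm]

/-- **Relabelling acts on generators by `ψ(X) ↦ ψ(e X)`.** [folklore] -/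
theorem map_funLeft_gen [DecidableEq Γ] [DecidableEq Γ'] (e : Γ ≃ Γ') (X : Γ) :
    ExteriorAlgebra.map (LinearMap.funLeft R R e.symm) (gen R X) = gen R (e X) := by
  rw [gen, ExteriorAlgebra.map_apply_ι, funLeft_symm_single, gen]

/-- Relabelling along `e` and then along `e⁻¹` is the identity. [folklore] -/
theorem map_funLeft_map_funLeft_symm (e : Γ ≃ Γ') (a : GrassmannAlgebra R Γ) :
    ExteriorAlgebra.map (LinearMap.funLeft R R e)
      (ExteriorAlgebra.map (LinearMap.funLeft R R e.symm) a) = a := by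
  rw [← AlgHom.comp_apply, ExteriorAlgebra.map_comp_map, ← LinearMap.funLeft_comp,
    Equiv.symm_comp_self,
    show LinearMap.funLeft R R (_root_.id : Γ → Γ) = LinearMap.id from LinearMap.ext fun _ => rfl,
    ExteriorAlgebra.map_id, AlgHom.id_apply]

/-- Relabelling along a bijection is injective. [folklore] -/
theorem map_funLeft_injective (e : Γ ≃ Γ') :
    Function.Injective (ExteriorAlgebra.map (LinearMap.funLeft R R (e.symm : Γ' → Γ))) :=
  Function.LeftInverse.injective (map_funLeft_map_funLeft_symm R e)

/-- Any linear substitution of the generators fixes the constant part. [folklore] -/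
theorem constPart_map (f : (Γ → R) →ₗ[R] (Γ' → R)) (a : GrassmannAlgebra R Γ) :
    constPart R (ExteriorAlgebra.map f a) = constPart R a := by
  suffices h : (constPart R).comp (ExteriorAlgebra.map f) = constPart R from AlgHom.congr_fun h a
  refine ExteriorAlgebra.hom_ext (LinearMap.ext fun v => ?_)
  simp only [LinearMap.comp_apply, AlgHom.toLinearMap_apply, AlgHom.comp_apply,
    ExteriorAlgebra.map_apply_ι, constPart_ι]

/-- **Derivatives are equivariant**: `∂_Y (F ∘ e⁻¹) = (∂_{e⁻¹ Y} F) ∘ e⁻¹`. [folklore] -/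
theorem grassmannDeriv_map_funLeft (e : Γ ≃ Γ') (Y : Γ') (a : GrassmannAlgebra R Γ) :
    grassmannDeriv R Y (ExteriorAlgebra.map (LinearMap.funLeft R R e.symm) a) =
      ExteriorAlgebra.map (LinearMap.funLeft R R e.symm) (grassmannDeriv R (e.symm Y) a) := by
  induction a using CliffordAlgebra.left_induction with
  | algebraMap r => rw [AlgHom.commutes, grassmannDeriv_algebraMap, grassmannDeriv_algebraMap, map_zero]
  | add x y hx hy => rw [map_add, map_add, hx, hy, map_add, map_add]
  | ι_mul x v hx =>
    rw [map_mul, ExteriorAlgebra.map_apply_ι, grassmannDeriv_ι_mul, hx, grassmannDeriv_ι_mul, map_sub,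
      map_smul, map_mul, ExteriorAlgebra.map_apply_ι, LinearMap.funLeft_apply]

/-- Peeling off the first derivative: `∂_{X_m}⋯∂_{X_1}∂_{X_0} a = (∂_{X_m}⋯∂_{X_1}) (∂_{X_0} a)`. [folklore] -/
theorem iterDeriv_succ_apply {m : ℕ} (X : Fin (m + 1) → Γ) (a : GrassmannAlgebra R Γ) :
    iterDeriv R X a = iterDeriv R (fun i => X i.succ) (grassmannDeriv R (X 0) a) := by
  rw [iterDeriv, iterDeriv, List.ofFn_succ, List.reverse_cons, List.prod_append, List.prod_singleton,
    Module.End.mul_apply]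

/-- Iterated derivatives are equivariant: `∂_{X_{m-1}}⋯∂_{X_0} (F ∘ e⁻¹) = (∂_{e⁻¹X_{m-1}}⋯∂_{e⁻¹X_0} F) ∘ e⁻¹`.
[folklore] -/
theorem iterDeriv_map_funLeft (e : Γ ≃ Γ') {m : ℕ} (X : Fin m → Γ') (a : GrassmannAlgebra R Γ) :
    iterDeriv R X (ExteriorAlgebra.map (LinearMap.funLeft R R e.symm) a) =
      ExteriorAlgebra.map (LinearMap.funLeft R R e.symm) (iterDeriv R (e.symm ∘ X) a) := by
  induction m generalizing a with
  | zero => simp [iterDeriv]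
  | succ m ih =>
    rw [iterDeriv_succ_apply, iterDeriv_succ_apply R (⇑e.symm ∘ X), grassmannDeriv_map_funLeft, ih]
    rfl

/-- Relabelling preserves nilpotency (it is injective). [folklore] -/
theorem nilpotencyClass_map_funLeft (e : Γ ≃ Γ') (a : GrassmannAlgebra R Γ) :
    nilpotencyClass (ExteriorAlgebra.map (LinearMap.funLeft R R e.symm) a) = nilpotencyClass a := by
  unfold nilpotencyClass
  congr 1
  ext k
  simp only [Set.mem_setOf_eq, ← map_pow]
  exact map_eq_zero_iff _ (map_funLeft_injective R e)

variable [Algebra ℚ R]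

/-- **Kernels of a relabelled element**: `kernel (F ∘ e⁻¹) m X = kernel F m (e⁻¹ ∘ X)` — no reordering
signs arise, the kernels being iterated derivatives. [folklore] -/
theorem kernel_map_funLeft (e : Γ ≃ Γ') (F : GrassmannAlgebra R Γ) (m : ℕ) (X : Fin m → Γ') :
    kernel R (ExteriorAlgebra.map (LinearMap.funLeft R R e.symm) F) m X = kernel R F m (e.symm ∘ X) := by
  rw [kernel, kernel, iterDeriv_map_funLeft, constPart_map]

/-- Relabelling commutes with the exponential (for every element: nilpotency classes agree). [folklore] -/
theorem map_funLeft_grassmannExp (e : Γ ≃ Γ') (a : GrassmannAlgebra R Γ) :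
    ExteriorAlgebra.map (LinearMap.funLeft R R e.symm) (grassmannExp a) =
      grassmannExp (ExteriorAlgebra.map (LinearMap.funLeft R R e.symm) a) := by
  rw [grassmannExp, grassmannExp, IsNilpotent.exp, IsNilpotent.exp, map_sum, nilpotencyClass_map_funLeft]
  simp only [map_rat_smul, map_pow]

/-- Relabelling commutes with the logarithm. [folklore] -/
theorem map_funLeft_grassmannLog1p (e : Γ ≃ Γ') (x : GrassmannAlgebra R Γ) :
    ExteriorAlgebra.map (LinearMap.funLeft R R e.symm) (grassmannLog1p R x) =
      grassmannLog1p R (ExteriorAlgebra.map (LinearMap.funLeft R R e.symm) x) := by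
  rw [grassmannLog1p, grassmannLog1p, map_sum, nilpotencyClass_map_funLeft]
  simp only [map_rat_smul, map_pow]

variable [Fintype Γ] [Fintype Γ']

/-- **The fermionic Laplacian is equivariant**: `Δ_C (F ∘ e⁻¹) = (Δ_{C ∘ (e × e)} F) ∘ e⁻¹`. [folklore] -/
theorem grassmannLaplacian_map_funLeft (e : Γ ≃ Γ') (C : Matrix Γ' Γ' R) (a : GrassmannAlgebra R Γ) :
    grassmannLaplacian R C (ExteriorAlgebra.map (LinearMap.funLeft R R e.symm) a) =
      ExteriorAlgebra.map (LinearMap.funLeft R R e.symm) (grassmannLaplacian R (C.submatrix e e) a) := by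
  rw [grassmannLaplacian_apply, grassmannLaplacian_apply, map_smul, map_sum, ← Equiv.sum_comp e]
  congr 1
  refine Finset.sum_congr rfl fun X _ => ?_
  rw [map_sum, ← Equiv.sum_comp e]
  refine Finset.sum_congr rfl fun Y _ => ?_
  rw [map_smul, Matrix.submatrix_apply, grassmannDeriv_map_funLeft, grassmannDeriv_map_funLeft,
    Equiv.symm_apply_apply, Equiv.symm_apply_apply]

/-- Powers of the Laplacian are equivariant. [folklore] -/
theorem grassmannLaplacian_pow_map_funLeft (e : Γ ≃ Γ') (C : Matrix Γ' Γ' R) (k : ℕ) (a : GrassmannAlgebra R Γ) :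
    (grassmannLaplacian R C ^ k) (ExteriorAlgebra.map (LinearMap.funLeft R R e.symm) a) =
      ExteriorAlgebra.map (LinearMap.funLeft R R e.symm) ((grassmannLaplacian R (C.submatrix e e) ^ k) a) := by
  induction k generalizing a with
  | zero => simp
  | succ k ih =>
    rw [pow_succ, pow_succ, Module.End.mul_apply, Module.End.mul_apply, grassmannLaplacian_map_funLeft, ih]

/-- **The Gaussian convolution is equivariant**: `μ_C ⋆ (F ∘ e⁻¹) = (μ_{C ∘ (e × e)} ⋆ F) ∘ e⁻¹`
(BGM 2006 §2.1: the symmetries of `P(dψ)`). [folklore] -/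
theorem gaussConv_map_funLeft (e : Γ ≃ Γ') (C : Matrix Γ' Γ' R) (a : GrassmannAlgebra R Γ) :
    gaussConv R C (ExteriorAlgebra.map (LinearMap.funLeft R R e.symm) a) =
      ExteriorAlgebra.map (LinearMap.funLeft R R e.symm) (gaussConv R (C.submatrix e e) a) := by
  obtain ⟨k₁, hk₁⟩ := isNilpotent_grassmannLaplacian R C
  obtain ⟨k₂, hk₂⟩ := isNilpotent_grassmannLaplacian R (C.submatrix e e)
  have h₁ : grassmannLaplacian R C ^ (k₁ + k₂) = 0 := by rw [pow_add, hk₁, zero_mul]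
  have h₂ : grassmannLaplacian R (C.submatrix e e) ^ (k₁ + k₂) = 0 := by rw [pow_add, hk₂, mul_zero]
  rw [gaussConv, gaussConv, IsNilpotent.exp_eq_sum h₁, IsNilpotent.exp_eq_sum h₂]
  simp only [LinearMap.coe_sum, Finset.sum_apply, LinearMap.smul_apply, map_sum, map_rat_smul,
    grassmannLaplacian_pow_map_funLeft]

/-- The effective Boltzmann factor is equivariant: `μ_C ⋆ e^{-V ∘ e⁻¹} = (μ_{C ∘ (e×e)} ⋆ e^{-V}) ∘ e⁻¹`.
[folklore] -/
theorem effBoltzmann_map_funLeft (e : Γ ≃ Γ') (C : Matrix Γ' Γ' R) (V : GrassmannAlgebra R Γ) :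
    effBoltzmann R C (ExteriorAlgebra.map (LinearMap.funLeft R R e.symm) V) =
      ExteriorAlgebra.map (LinearMap.funLeft R R e.symm) (effBoltzmann R (C.submatrix e e) V) := by
  rw [effBoltzmann, effBoltzmann, ← map_neg, ← map_funLeft_grassmannExp, gaussConv_map_funLeft]

/-- The normalised partition function is invariant: `∫ dμ_C e^{-V ∘ e⁻¹} = ∫ dμ_{C ∘ (e×e)} e^{-V}`.
[folklore] -/
theorem effPartitionFn_map_funLeft (e : Γ ≃ Γ') (C : Matrix Γ' Γ' R) (V : GrassmannAlgebra R Γ) :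
    effPartitionFn R C (ExteriorAlgebra.map (LinearMap.funLeft R R e.symm) V) =
      effPartitionFn R (C.submatrix e e) V := by
  rw [effPartitionFn, effBoltzmann_map_funLeft, constPart_map, effPartitionFn]

/-- **The Wilsonian effective action is equivariant under relabelling the fields**:
`effAction C (V ∘ e⁻¹) = (effAction (C ∘ (e × e)) V) ∘ e⁻¹` (the symmetries of the Gaussian
integration and of the interaction pass to the effective action; BGM 2006 §2.1). [folklore] -/
theorem effAction_map_funLeft (e : Γ ≃ Γ') (C : Matrix Γ' Γ' R) (V : GrassmannAlgebra R Γ) :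
    effAction R C (ExteriorAlgebra.map (LinearMap.funLeft R R e.symm) V) =
      ExteriorAlgebra.map (LinearMap.funLeft R R e.symm) (effAction R (C.submatrix e e) V) := by
  rw [effAction, effAction, effPartitionFn_map_funLeft, effBoltzmann_map_funLeft, map_neg,
    map_funLeft_grassmannLog1p, map_sub, map_one, map_smul]

/-! ### Symmetries: a permutation of one label set preserving covariance and interaction -/

omit [Fintype Γ'] in
/-- **A symmetry of covariance and interaction is a symmetry of the effective action**: for a
permutation `σ` of the labels with `C (σ X) (σ Y) = C X Y` and `V ∘ σ⁻¹ = V`,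
`(effAction C V) ∘ σ⁻¹ = effAction C V` (BGM 2006 §2.1). [folklore] -/
theorem map_funLeft_effAction_of_invariant (σ : Equiv.Perm Γ) {C : Matrix Γ Γ R}
    (hC : ∀ X Y, C (σ X) (σ Y) = C X Y) {V : GrassmannAlgebra R Γ}
    (hV : ExteriorAlgebra.map (LinearMap.funLeft R R σ.symm) V = V) :
    ExteriorAlgebra.map (LinearMap.funLeft R R σ.symm) (effAction R C V) = effAction R C V := by
  have hC' : C.submatrix σ σ = C := Matrix.ext fun X Y => hC X Y
  have h := effAction_map_funLeft R σ C V
  rwa [hV, hC', eq_comm] at h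

omit [Fintype Γ'] in
/-- A symmetry of the covariance leaves the normalised partition function of every (relabelled)
interaction unchanged: `∫ dμ_C e^{-V ∘ σ⁻¹} = ∫ dμ_C e^{-V}`. [folklore] -/
theorem effPartitionFn_of_invariant (σ : Equiv.Perm Γ) {C : Matrix Γ Γ R}
    (hC : ∀ X Y, C (σ X) (σ Y) = C X Y) (V : GrassmannAlgebra R Γ) :
    effPartitionFn R C (ExteriorAlgebra.map (LinearMap.funLeft R R σ.symm) V) = effPartitionFn R C V := by
  have hC' : C.submatrix σ σ = C := Matrix.ext fun X Y => hC X Y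
  rw [effPartitionFn_map_funLeft, hC']

omit [Fintype Γ] [Fintype Γ'] in
/-- **Kernels of an invariant element are invariant**: if `F ∘ σ⁻¹ = F` then
`kernel F m (σ ∘ X) = kernel F m X` for every degree `m` and label string `X`. [folklore] -/
theorem kernel_comp_perm_of_invariant (σ : Equiv.Perm Γ) {F : GrassmannAlgebra R Γ}
    (hF : ExteriorAlgebra.map (LinearMap.funLeft R R σ.symm) F = F) (m : ℕ) (X : Fin m → Γ) :
    kernel R F m (σ ∘ X) = kernel R F m X := by
  conv_lhs => rw [← hF]
  rw [kernel_map_funLeft]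
  congr 1
  funext i
  exact σ.symm_apply_apply (X i)

end Relabel

end Literature.MathematicalPhysics.QuantumLattice
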